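import Summits.BirchSwinnertonDyer.Rank1Residual.Additive.X3BranchKummerLayerTwoUnits
import Summits.BirchSwinnertonDyer.Rank1Residual.Additive.X3BranchKummerLayerUnitsSum
import HarnessLib

/-!
# X3, the DEGENERATE rows OFF the sub-locus, LAYER TWO: the class of a PRODUCT of `Σ₀`-units of the
# second layer `ℚ_2 = ℚ(θ₂)` lies in Greenberg–Vatsal's `U` (cell `bsd-eis`, seat `bsd-eis-x3` gen 8;
# the layer-`2` analogue of gen 7's `X3BranchKummerLayerUnitsSum.lean`, on top of
# `LayerTwoField.kummerClass_mem_unramifiedSelmer_layerTwo`'s conjugate-free design; x3-MEMO-10 §5;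
# route K1 `AdditiveBranchIMC`, crux `GordTwoRankZeroOffCaseOne` — supports only)

HONEST FRAMING (`run/shared/lean/pub/bsd-eis/README.md` §4): THEOREMS ONLY (no `def`, no named fact,
no `sorry`); nothing is booked; no label, tier or count of record moves.

* `kummerSumClass_mem_unramifiedSelmer_layerTwo` — `κ` cyclotomic, `Ψ` a discrete `ω`-line with
  `3y₀ = 0`, `θ₂ = ζ + ζ²⁶` (`ζ` of order `27`) with its multiplication table `μ`; units
  `a_i = Σ_k P_{ik} θ₂^k` with cofactors `b_i` (`a_i b_i = n_i ≠ 0`, primes of `n_i` under `Σ₀`) and one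
  cube certificate each; cube roots `β_i`, exponents `k_i`; `F` a cocycle on `ker κ` with
  `F(h) = m_h y₀`, `h∏β_i^{k_i} = ζ₃^{m_h}∏β_i^{k_i}` (`ζ₃ = ζ⁹`). Then `[F] ∈ unramifiedSelmer (ker κ) Ψ 3 Σ₀`.
References: [GreenbergVatsal2000] §2 pp. 28–29; [SerreLocalFields1979] Ch. X §3.
-/

set_option autoImplicit false

noncomputable section

open scoped Classical NumberField

namespace Summit.BirchSwinnertonDyer.Rank1Residual.Additive

namespace LayerTwoField

open NumberField IsDedekindDomain Field Finset
  Literature.NumberTheory.GaloisRepresentations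
  Literature.NumberTheory.EllipticCurves
  Literature.NumberTheory.EllipticCurves.GreenbergSelmer
  Literature.NumberTheory.EllipticCurves.GreenbergVatsal2000
  Literature.NumberTheory.NumberFields
  KummerLineClasses KummerLayerClasses

/-- **The class of a product of layer-two units lies in `U`.** See the module docstring.
[cite: GreenbergVatsal2000, §2 pp. 28–29] [cite: SerreLocalFields1979, Ch. X §3] -/
theorem kummerSumClass_mem_unramifiedSelmer_layerTwo [hp : Fact (Nat.Prime 3)] (κ : ZpExtension ℚ 3)
    (hκ : κ.IsCyclotomic) (S₀ : Finset (HeightOneSpectrum (𝓞 ℚ)))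
    {Ψ : Type} [AddCommGroup Ψ] [DistribMulAction (absoluteGaloisGroup ℚ) Ψ]
    [TopologicalSpace Ψ] [DiscreteTopology Ψ]
    (hΨ : ∀ (σ : absoluteGaloisGroup ℚ) (y : Ψ),
      σ • y = ((modNCyclotomicCharacter ℚ 3 σ : (ZMod 3)ˣ) : ZMod 3).val • y)
    {y₀ : Ψ} (hy₀3 : 3 • y₀ = 0) {ζ : AlgebraicClosure ℚ} (hζ : IsPrimitiveRoot ζ 27)
    (μ : Fin 9 → Fin 9 → Fin 9 → ℤ)
    (hθtab : ∀ i j : Fin 9, (ζ + ζ ^ 26) ^ (i : ℕ) * (ζ + ζ ^ 26) ^ (j : ℕ) =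
      ∑ k : Fin 9, (μ k i j : AlgebraicClosure ℚ) * (ζ + ζ ^ 26) ^ (k : ℕ))
    {ι : Type} [Fintype ι] (P B D T : ι → Fin 9 → ℤ) (n : ι → ℕ) (hn0 : ∀ i, n i ≠ 0)
    (hab : ∀ i, (∑ k : Fin 9, (P i k : AlgebraicClosure ℚ) * (ζ + ζ ^ 26) ^ (k : ℕ)) *
      (∑ k : Fin 9, (B i k : AlgebraicClosure ℚ) * (ζ + ζ ^ 26) ^ (k : ℕ)) = (n i : AlgebraicClosure ℚ))
    (hnS : ∀ i (v : HeightOneSpectrum (𝓞 ℚ)), ((n i : ℕ) : 𝓞 ℚ) ∈ v.asIdeal → v ∈ S₀)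
    (hcube : ∀ i, (∑ k : Fin 9, (P i k : AlgebraicClosure ℚ) * (ζ + ζ ^ 26) ^ (k : ℕ)) *
      (∑ k : Fin 9, (D i k : AlgebraicClosure ℚ) * (ζ + ζ ^ 26) ^ (k : ℕ)) ^ 3 =
      1 + 9 * ∑ k : Fin 9, (T i k : AlgebraicClosure ℚ) * (ζ + ζ ^ 26) ^ (k : ℕ))
    (β : ι → AlgebraicClosure ℚ)
    (hβ' : ∀ i, β i ^ 3 = ∑ k : Fin 9, (P i k : AlgebraicClosure ℚ) * (ζ + ζ ^ 26) ^ (k : ℕ))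
    (k : ι → ℕ) (F : contOneCocycles (discreteTopRep κ.kerSubgroup Ψ))
    (hF : ∀ h : κ.kerSubgroup, ∃ m : ℕ, (h : absoluteGaloisGroup ℚ) • (∏ i, β i ^ k i) =
      (ζ ^ 9) ^ m * ∏ i, β i ^ k i ∧ F.1 h = m • y₀) :
    oneCocycleClass (discreteTopRep κ.kerSubgroup Ψ) F ∈
      unramifiedSelmer κ.kerSubgroup Ψ 3 (↑S₀ : Set (HeightOneSpectrum (𝓞 ℚ))) := by
  haveI : NeZero ((3 : ℕ) : ℚ) := ⟨by norm_num⟩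
  set θ : AlgebraicClosure ℚ := ζ + ζ ^ 26 with hθdef
  have hζ₃ : IsPrimitiveRoot (ζ ^ 9) 3 := hζ.pow (by norm_num) (by norm_num)
  have hkerθ : ∀ σ ∈ κ.kerSubgroup, σ • θ = θ := by
    intro σ hσ
    have hmem := zeta_add_pow_mem_layer_two hκ ζ hζ.pow_eq_one
    rw [ZpExtension.layer, IntermediateField.mem_fixedField_iff] at hmem
    exact hmem _ (Subgroup.mem_map.mpr ⟨σ, κ.kerSubgroup_le_layerSubgroup 2 hσ, rfl⟩)
  set a : ι → AlgebraicClosure ℚ := fun i ↦ ∑ kk : Fin 9, (P i kk : AlgebraicClosure ℚ) * θ ^ (kk : ℕ)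
    with hadef
  have hβa : ∀ i, β i ^ 3 = a i := fun i ↦ hβ' i
  have ha0 : ∀ i, a i ≠ 0 := fun i h0 ↦ hn0 i (by
    have := hab i
    rw [show (∑ kk : Fin 9, (P i kk : AlgebraicClosure ℚ) * (ζ + ζ ^ 26) ^ (kk : ℕ)) = a i from rfl,
      h0, zero_mul] at this
    exact_mod_cast this.symm)
  have hβ0 : ∀ i, β i ≠ 0 := fun i h0 ↦ by
    have := hβa i; rw [h0, zero_pow three_ne_zero] at this; exact ha0 i this.symm
  refine mem_unramifiedSelmer_of_conj_of_mem κ.kerSubgroup 3 F (↑S₀) fun τ ↦ ?_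
  -- conjugate data per unit
  choose P' hP' using fun i ↦ exists_intVector9_smul hζ τ (P i)
  choose B' hB' using fun i ↦ exists_intVector9_smul hζ τ (B i)
  have hτa : ∀ i, τ • a i = ∑ kk : Fin 9, (P' i kk : AlgebraicClosure ℚ) * θ ^ (kk : ℕ) := fun i ↦ hP' i
  have hcof : ∀ i, ∃ b : AlgebraicClosure ℚ, IsIntegral (𝓞 ℚ) b ∧ (τ • a i) * b = n i := fun i ↦
    ⟨∑ kk : Fin 9, (B' i kk : AlgebraicClosure ℚ) * θ ^ (kk : ℕ), isIntegral_sum9 hζ (B' i), by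
      rw [← hB', ← smul_mul']
      change τ • ((∑ kk : Fin 9, (P i kk : AlgebraicClosure ℚ) * (ζ + ζ ^ 26) ^ (kk : ℕ)) *
        ∑ kk : Fin 9, (B i kk : AlgebraicClosure ℚ) * (ζ + ζ ^ 26) ^ (kk : ℕ)) = _
      rw [hab i, absoluteGaloisGroup.smul_def, map_natCast]⟩
  -- good roots of the conjugates
  choose βτ hβτ hβτfix using fun i ↦ exists_goodRoot_layerTwo hκ hζ μ hθtab (P i) (D i) (T i) (hcube i) τ
  have hτβ3 : ∀ i, (τ • β i) ^ 3 = τ • a i := fun i ↦ by rw [← smul_pow', hβa i]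
  have hτa0 : ∀ i, τ • a i ≠ 0 := fun i h0 ↦ by
    obtain ⟨b, -, hb⟩ := hcof i
    rw [h0, zero_mul] at hb
    exact hn0 i (by exact_mod_cast hb.symm)
  have hτβ0 : ∀ i, τ • β i ≠ 0 := fun i h0 ↦ by
    have := hτβ3 i; rw [h0, zero_pow three_ne_zero] at this; exact hτa0 i this.symm
  have hβτ' : ∀ i, βτ i ^ 3 = τ • a i := fun i ↦ hβτ i
  have hjj : ∀ i, ∃ jj : ℕ, βτ i = (ζ ^ 9) ^ jj * (τ • β i) := fun i ↦ by
    have hq' : (βτ i / (τ • β i)) ^ 3 = 1 := by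
      rw [div_pow, hβτ' i, ← hτβ3 i, div_self (pow_ne_zero _ (hτβ0 i))]
    obtain ⟨jj, -, hζj⟩ := hζ₃.eq_pow_of_pow_eq_one hq'
    exact ⟨jj, by rw [hζj, div_mul_cancel₀ _ (hτβ0 i)]⟩
  choose jj hjj using hjj
  have hβτ0 : ∀ i, βτ i ≠ 0 := fun i ↦ by
    rw [hjj i]; exact mul_ne_zero (pow_ne_zero _ (hζ₃.ne_zero three_ne_zero)) (hτβ0 i)
  -- `ker κ` fixes `τ a_i`
  have hkerτa : ∀ i, ∀ σ ∈ κ.kerSubgroup, σ • (τ • a i) = τ • a i := fun i σ hσ ↦ by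
    rw [hτa i, smul_sum9, hkerθ σ hσ]
  -- Kummer cocycles of `τ a_i`
  choose fτ hfτc hfτcoc hfτrel using fun i ↦
    exists_kummerCocycle (p := 3) κ.kerSubgroup hΨ y₀ hy₀3 hζ₃ (hτa0 i) (hkerτa i) (hβτ' i)
  choose f₁ hf₁c hf₁coc hf₁rel using fun i ↦
    exists_kummerCocycle (p := 3) κ.kerSubgroup hΨ y₀ hy₀3 hζ₃ (hτa0 i) (hkerτa i) (hτβ3 i)
  set Fτ : absoluteGaloisGroup ℚ → Ψ := fun σ ↦ ∑ i, k i • fτ i σ with hFτdef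
  set F₁ : absoluteGaloisGroup ℚ → Ψ := fun σ ↦ ∑ i, k i • f₁ i σ with hF₁def
  have hFτc' : Continuous Fτ := continuous_finsetSum _ fun i _ ↦ (continuous_nsmul (k i)).comp (hfτc i)
  have hF₁c' : Continuous F₁ := continuous_finsetSum _ fun i _ ↦ (continuous_nsmul (k i)).comp (hf₁c i)
  have hFτcoc' : ∀ σ ∈ κ.kerSubgroup, ∀ σ' ∈ κ.kerSubgroup, Fτ (σ * σ') = Fτ σ + σ • Fτ σ' :=
    fun σ hσ σ' hσ' ↦ by
      simp only [hFτdef, hfτcoc _ σ hσ σ' hσ', nsmul_add, Finset.sum_add_distrib, Finset.smul_sum, smul_comm σ]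
  have hF₁coc' : ∀ σ ∈ κ.kerSubgroup, ∀ σ' ∈ κ.kerSubgroup, F₁ (σ * σ') = F₁ σ + σ • F₁ σ' :=
    fun σ hσ σ' hσ' ↦ by
      simp only [hF₁def, hf₁coc _ σ hσ σ' hσ', nsmul_add, Finset.sum_add_distrib, Finset.smul_sum, smul_comm σ]
  obtain ⟨Fτc, -, hFτc1, -⟩ := exists_class_of_cocycle κ.kerSubgroup le_rfl Fτ hFτc' hFτcoc'
  obtain ⟨F₁c, -, hF₁c1, -⟩ := exists_class_of_cocycle κ.kerSubgroup le_rfl F₁ hF₁c' hF₁coc'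
  -- products
  set Bp : AlgebraicClosure ℚ := ∏ i, β i ^ k i with hBdef
  have hB0 : Bp ≠ 0 := Finset.prod_ne_zero_iff.mpr fun i _ ↦ pow_ne_zero _ (hβ0 i)
  have hτB : τ • Bp = ∏ i, (τ • β i) ^ k i := by
    rw [hBdef, Finset.smul_prod']
    exact Finset.prod_congr rfl fun i _ ↦ smul_pow' _ _ _
  have hτB0 : τ • Bp ≠ 0 := by
    rw [hτB]; exact Finset.prod_ne_zero_iff.mpr fun i _ ↦ pow_ne_zero _ (hτβ0 i)
  set J : ℕ := ∑ i, jj i * k i with hJ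
  have hprodτ : ∏ i, βτ i ^ k i = (ζ ^ 9) ^ J * (τ • Bp) := by
    rw [hτB, hJ, ← Finset.prod_pow_eq_pow_sum, ← Finset.prod_mul_distrib]
    exact Finset.prod_congr rfl fun i _ ↦ by rw [hjj i, mul_pow, ← pow_mul]
  -- vanishing of the good cocycles on `I_v ∩ ker κ`
  have hvanI : ∀ (v : HeightOneSpectrum (𝓞 ℚ)), v ∉ (↑S₀ : Set (HeightOneSpectrum (𝓞 ℚ))) ∨
      ((3 : ℕ) : 𝓞 ℚ) ∈ v.asIdeal → ∀ σ ∈ inertia v, σ ∈ κ.kerSubgroup → ∀ i, fτ i σ = 0 := by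
    intro v hv σ hσ hσker i
    obtain ⟨m, hm, hfm⟩ := hfτrel i σ hσker
    have hfix : σ • βτ i = βτ i := by
      by_cases hv3 : ((3 : ℕ) : 𝓞 ℚ) ∈ v.asIdeal
      · have hvv : v = (Rat.HeightOneSpectrum.primesEquiv (R := 𝓞 ℚ)).symm ⟨3, Nat.prime_three⟩ := by
          have h1 := (Literature.NumberTheory.Automorphic.BCDT.natCast_mem_asIdeal_iff_primesEquiv_eq v hp.out).mp hv3
          exact Rat.HeightOneSpectrum.primesEquiv.injective
            (by rw [Equiv.apply_symm_apply]; exact Subtype.ext h1)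
        rw [hvv] at hσ
        exact hβτfix i σ (inertia_le_decomp _ hσ) (hkerθ σ hσker)
      · have hvS : v ∉ (↑S₀ : Set (HeightOneSpectrum (𝓞 ℚ))) := hv.resolve_right hv3
        obtain ⟨b, hbint, hb⟩ := hcof i
        exact smul_eq_self_of_mem_inertia_of_pow_eq_of_dvd (p := 3) hζ₃
          (by rw [hτa i]; exact isIntegral_sum9 hζ (P' i)) hbint hb (hβτ' i) hv3
          (fun hnv ↦ hvS (hnS i v hnv)) hσ (hkerτa i σ hσker)
    rw [hfix] at hm
    have hζm : (ζ ^ 9) ^ m = 1 := by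
      have h1 : (ζ ^ 9) ^ m * βτ i = 1 * βτ i := by rw [one_mul]; exact hm.symm
      exact mul_right_cancel₀ (hβτ0 i) h1
    obtain ⟨kk, rfl⟩ := (hζ₃.pow_eq_one_iff_dvd m).mp hζm
    rw [hfm, mul_nsmul, hy₀3, nsmul_zero]
  refine ⟨Fτ, Fτc, hFτc1, ?_, ?_, ?_⟩
  · have e1 : conjH1 κ.kerSubgroup Ψ τ
        (oneCocycleClass (discreteTopRep κ.kerSubgroup Ψ) F) =
        oneCocycleClass (discreteTopRep κ.kerSubgroup Ψ) F₁c :=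
      conjH1_eq_of_kummer (p := 3) κ.kerSubgroup hΨ hy₀3 hζ₃ hB0 τ F F₁c hF
        (fun h ↦ by
          obtain ⟨m, hm, hFm⟩ := rel_sum_at Finset.univ y₀ (fun i ↦ τ • β i) f₁ h
            (fun i _ ↦ hf₁rel i h h.2) (fun i ↦ k i)
          refine ⟨m, by rw [hτB]; exact hm, by rw [hF₁c1]; exact hFm⟩)
    have e2 : oneCocycleClass (discreteTopRep κ.kerSubgroup Ψ) Fτc =
        oneCocycleClass (discreteTopRep κ.kerSubgroup Ψ) F₁c :=
      class_eq_of_root_mul_pow (p := 3) κ.kerSubgroup hΨ hy₀3 hζ₃ hτB0 J F₁c Fτc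
        (fun h ↦ by
          obtain ⟨m, hm, hFm⟩ := rel_sum_at Finset.univ y₀ (fun i ↦ τ • β i) f₁ h
            (fun i _ ↦ hf₁rel i h h.2) (fun i ↦ k i)
          refine ⟨m, by rw [hτB]; exact hm, by rw [hF₁c1]; exact hFm⟩)
        (fun h ↦ by
          obtain ⟨m, hm, hFm⟩ := rel_sum_at Finset.univ y₀ βτ fτ h
            (fun i _ ↦ hfτrel i h h.2) (fun i ↦ k i)
          refine ⟨m, by rw [← hprodτ]; exact hm, by rw [hFτc1]; exact hFm⟩)
    rw [e1, e2]
  · intro v hvS σ hσ hσker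
    simp only [hFτdef]
    exact Finset.sum_eq_zero fun i _ ↦ by rw [hvanI v (Or.inl hvS) σ hσ hσker i, nsmul_zero]
  · intro v hv3 σ hσ hσker
    simp only [hFτdef]
    exact Finset.sum_eq_zero fun i _ ↦ by rw [hvanI v (Or.inr hv3) σ hσ hσker i, nsmul_zero]

end LayerTwoField

end Summit.BirchSwinnertonDyer.Rank1Residual.Additive

end
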